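import Summits.QuantumFields.QCD.Theorems.QuarksAsStableActionStableActionBridgeProjChainDet
import Summits.QuantumFields.QCD.Theorems.QuarksAsStableActionStableActionBridgeChainBlockInverse
import Summits.QuantumFields.QCD.Theorems.QuarksAsStableActionStableActionBridgeDressedTransferTwo
import Summits.QuantumFields.QCD.Theorems.QuarksAsStableActionStableActionBridgeFermionSliceOpCovariance
import Summits.QuantumFields.QCD.Theorems.HeatSlicedQuarksRobustYangMillsHandoverStubChainBlockInsertionAlgebra
import Summits.QuantumFields.QCD.Theorems.HeatSlicedQuarksRobustYangMillsHandoverStubSupertraceUndressInsert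
import Summits.QuantumFields.QCD.Theorems.HeatSlicedQuarksRobustYangMillsHandoverStubGammaConjDGamma
import HarnessLib

/-!
# Stub `stub_wilsonChain_undress_insertion` of line `pin-the-infimum` (crux `RobustYangMillsHandover`, 8892)

E2, layer F2 (Fock level) of the fermionic-insertion bricks in Lüscher's transfer-matrix
representation of the QCD torus functional: **undressing the temporal transporters in the presence
of a source insertion**, for Wilson-structured slice operators `A_t = Bh_t + C_t`.

The one-slice source derivative of the projector-chain determinant (F1, landed as
`stub_projChain_det_hasDerivAt_source`) is `(∏ det E) · STr ∏_{i<T} (𝒥_i Γ(N_i))` with the DRESSED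
one-step matrices `N_i = −E_i⁻¹ F_i` (`E_t = A_t P⁻ − P⁺ W′_{t−1}`, `F_t = A_t P⁺ − P⁻ W_t`,
`Γ = fockLift`) and the insertion `𝒥_{t₀} = dΓ(E⁻¹ J (P⁻ − P⁺ F⁻¹ E)) − tr(E⁻¹ J P⁻)·1` at the
source slice (`𝒥_i = 1` otherwise).  For Wilson slice operators the chain block has the explicit
inverse `Ẽ_t = −W_{t−1} P⁺ + W_{t−1} P⁺ C_t Bh_t⁻¹ P⁻ + Bh_t⁻¹ P⁻` and the one-step matrix is
Lüscher's positive core dressed by the transporters,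
`N_t = S_{t−1} · M′_t W_t · S_t⁻¹`, `S_t = W_t P⁺ + P⁻`, `S_t⁻¹ = W′_t P⁺ + P⁻`,
`M′ = (1 + P⁺ C P⁻)(Bh P⁺ + Bh⁻¹ P⁻)(1 − P⁻ C P⁺)`.  Hence `Γ(N_i) = Γ(S_{i−1}) Γ(M′_i W_i) Γ(S_i)⁻¹`,
the cyclic supertrace undresses (landed `stub_supertrace_undress_insert`), and the insertion gets
conjugated: `Γ(S_{t₀−1})⁻¹ 𝒥 Γ(S_{t₀−1}) = dΓ(S⁻¹ Z S) − tr(E⁻¹ J P⁻)·1` (covariance of `dΓ`,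
landed `stub_Gamma_conj_dGamma`) with the LINK-FREE one-particle matrix
`S⁻¹ Z S = K_J = (−P⁺ + P⁺ C Bh⁻¹ P⁻ + Bh⁻¹ P⁻) J (P⁻ + P⁺ M′ᵢ)`,
`M′ᵢ = (1 + P⁻ C P⁺)(Bh⁻¹ P⁺ + Bh P⁻)(1 − P⁺ C P⁻) = M′⁻¹`, and `tr(E⁻¹ J P⁻) = tr(J Bh⁻¹ P⁻)`
(landed `stub_chainBlock_insertion_algebra`).  No temporal link survives in the insertion.

## Proof

* `StubWilsonChainUndressInsertion.neg_inv_mul_eq_dressed` — per slice,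
  `−E⁻¹ F = (W₁ P⁺ + P⁻)(M′ W₂)(W₂′ P⁺ + P⁻)`: `E⁻¹ = Ẽ` (`projChainBlock_mul_explicitInv` and
  `Matrix.inv_eq_right_inv`), the dressed form `−Ẽ F = (W₁P⁺ + P⁻) M′ (P⁺ + W₂P⁻)`
  (`neg_explicitInv_mul_eq_dressed_two`) and `P⁺ + W₂ P⁻ = W₂ (W₂′ P⁺ + P⁻)`;
* `StubWilsonChainUndressInsertion.insertion_undress` — the one-particle insertion identities:
  `F⁻¹ E = −Nᵢ` (from `N Nᵢ = 1`, `E Ẽ = 1`, so `F (−Nᵢ Ẽ) = 1`), hence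
  `P⁻ − P⁺ F⁻¹ E = P⁻ + P⁺ Nᵢ`, and conjuncts 5–6 of `stub_chainBlock_insertion_algebra`
  (with `Bi = Bh⁻¹`);
* `StubWilsonChainUndressInsertion.fockLift_conj_dGamma_sub_smul` —
  `Γ(gᵢ)(dΓ(Z) − c·1)Γ(g) = dΓ(gᵢ Z g) − c·1` for `gᵢ g = 1`;
* `StubWilsonChainUndressInsertion.supertrace_undress_of_dressing` — the Fock-level assembly:
  factorise `Γ(reindex N_i)` (`reindex` and `Γ` are multiplicative:
  `FermionSliceOpCovariance.reindex_mul_reindex`, `fockLift_mul`), apply the landed undressing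
  identity with `S_t ↦ reindex (W_t P⁺ + P⁻)`, and simplify the conjugated insertions
  (`Γ(S⁻¹) 1 Γ(S) = 1` off the source slice).

The registered signature is then the assembly at the lifted Wilson time projections
`P± = 1 ⊗ 1 ⊗ ½(1 ± γ₀)` (`liftProjPlus_add_liftProjMinus`, `liftProjPlus_mul_liftProjMinus`,
`liftProjMinus_mul_liftProjPlus`).  Pure theorem file (no definitions); `NeZero T` is not used.

References: M. Lüscher, *Construction of a selfadjoint, strictly positive transfer matrix for
Euclidean lattice gauge theories*, Comm. Math. Phys. 54 (1977) 283–292; I. Montvay, G. Münster,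
*Quantum Fields on a Lattice* (CUP 1994), §4 (transfer matrix for Wilson fermions); J. Smit,
*Introduction to Quantum Fields on a Lattice*, §6.5.
-/

namespace Summit.QuantumFields.QCD.Cruxes.RobustYangMillsHandover.PinTheInfimum

open Literature.MathematicalPhysics.QuantumLattice Literature.MathematicalPhysics.QuantumFieldTheory
open Summit.QuantumFields.QCD.Cruxes.StableActionBridge.Sketch
open Summit.QuantumFields.QCD.Cruxes.StableActionBridge.Sketch.FockLiftPosDef
open Summit.QuantumFields.QCD.Cruxes.StableActionBridge.Sketch.FermionSliceOpCovariance

namespace StubWilsonChainUndressInsertion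

/-! ### One-particle (matrix) identities -/

section OneParticle

variable {n : Type} [Fintype n] [DecidableEq n]

/-- Complementary annihilating summands of `1` are idempotent: `P + Q = 1`, `P Q = 0` give
`P² = P`. [folklore] -/
theorem mul_self_of_add_eq_one {P Q : Matrix n n ℂ} (h1 : P + Q = 1) (h0 : P * Q = 0) :
    P * P = P := by
  -- adapted from `WilsonTransfer.mul_self_of_add_eq_one` (StableActionBridge, line `Sketch`)
  have h : P * (P + Q) = P := by rw [h1, Matrix.mul_one]
  rwa [Matrix.mul_add, h0, add_zero] at h

/-- Complementary annihilating summands of `1` are idempotent: `P + Q = 1`, `Q P = 0` give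
`Q² = Q`. [folklore] -/
theorem mul_self_of_add_eq_one' {P Q : Matrix n n ℂ} (h1 : P + Q = 1) (h0 : Q * P = 0) :
    Q * Q = Q := by
  have h : Q * (P + Q) = Q := by rw [h1, Matrix.mul_one]
  rwa [Matrix.mul_add, h0, zero_add] at h

/-- **The dressed one-step matrix with the right transporter split off**: for the Wilson chain
blocks `E = (Bh + C) P⁻ − P⁺ W₁′`, `F = (Bh + C) P⁺ − P⁻ W₂` (`W₁′ W₁ = 1`, `W₂ W₂′ = 1`),
`−E⁻¹ F = (W₁ P⁺ + P⁻) · (M′ W₂) · (W₂′ P⁺ + P⁻)` with Lüscher's positive core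
`M′ = (1 + P⁺ C P⁻)(Bh P⁺ + Bh⁻¹ P⁻)(1 − P⁻ C P⁺)`: `E⁻¹` is the explicit inverse
`Ẽ = −W₁ P⁺ + W₁ P⁺ C Bh⁻¹ P⁻ + Bh⁻¹ P⁻` (`projChainBlock_mul_explicitInv`), `−Ẽ F` is the dressed
core (`neg_explicitInv_mul_eq_dressed_two`) and `P⁺ + W₂ P⁻ = W₂ (W₂′ P⁺ + P⁻)`.
[cite: Luscher1977, pp. 283–292] -/
theorem neg_inv_mul_eq_dressed (Pp Pm Bh C W₁ W₁' W₂ W₂' : Matrix n n ℂ) (h1 : Pp + Pm = 1)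
    (hPP : Pp * Pp = Pp) (hQQ : Pm * Pm = Pm) (hPQ : Pp * Pm = 0) (hQP : Pm * Pp = 0)
    (hBP : Bh * Pp = Pp * Bh) (hBQ : Bh * Pm = Pm * Bh) (hPCP : Pp * C * Pp = 0)
    (hQCQ : Pm * C * Pm = 0) (hW₁Q : W₁ * Pm = Pm * W₁) (hW₁'P : W₁' * Pp = Pp * W₁')
    (hW₁'W₁ : W₁' * W₁ = 1) (hW₂Q : W₂ * Pm = Pm * W₂) (hW₂W₂' : W₂ * W₂' = 1)
    (hBh : IsUnit Bh.det) :
    -(((Bh + C) * Pm - Pp * W₁')⁻¹ * ((Bh + C) * Pp - Pm * W₂)) =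
      (W₁ * Pp + Pm) * ((1 + Pp * C * Pm) * (Bh * Pp + Bh⁻¹ * Pm) * (1 - Pm * C * Pp) * W₂) *
        (W₂' * Pp + Pm) := by
  have hE : ((Bh + C) * Pm - Pp * W₁') * (-(W₁ * Pp) + W₁ * Pp * C * Bh⁻¹ * Pm + Bh⁻¹ * Pm) = 1 :=
    projChainBlock_mul_explicitInv n Pp Pm Bh C W₁ W₁' h1 hPP hQQ hPQ hQP hBP hBQ hQCQ hW₁'P hW₁Q
      hW₁'W₁ hBh
  rw [Matrix.inv_eq_right_inv hE,
    neg_explicitInv_mul_eq_dressed_two n Pp Pm Bh C W₁ W₂ hPP hQQ hPQ hQP hBP hBQ hPCP hW₂Q hBh]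
  have hd : Pp + W₂ * Pm = W₂ * (W₂' * Pp + Pm) := by
    rw [Matrix.mul_add, ← Matrix.mul_assoc, hW₂W₂', Matrix.one_mul]
  rw [hd]
  simp only [Matrix.mul_assoc]

/-- **The link-free one-particle insertion.**  For the Wilson chain blocks
`E = (Bh + C) P⁻ − P⁺ W₁′`, `F = (Bh + C) P⁺ − P⁻ W₂` with mutually inverse transporter pairs
`W₁, W₁′` and `W₂, W₂′` commuting with `P±`:
(1) conjugating the insertion matrix `Z = E⁻¹ J (P⁻ − P⁺ F⁻¹ E)` by `S₁ = W₁ P⁺ + P⁻` removes all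
temporal links, `S₁⁻¹ Z S₁ = (−P⁺ + P⁺ C Bh⁻¹ P⁻ + Bh⁻¹ P⁻) J (P⁻ + P⁺ M′ᵢ)` with
`M′ᵢ = (1 + P⁻ C P⁺)(Bh⁻¹ P⁺ + Bh P⁻)(1 − P⁺ C P⁻)`; (2) `tr(E⁻¹ J P⁻) = tr(J Bh⁻¹ P⁻)`.
Here `E⁻¹ = Ẽ` is the explicit inverse and `F⁻¹ E = −Nᵢ` for the explicit inverse `Nᵢ` of the
one-step matrix `N = −Ẽ F` (`N Nᵢ = 1` and `E Ẽ = 1` give `F (−Nᵢ Ẽ) = 1`), which reduces both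
claims to conjuncts 5–6 of `stub_chainBlock_insertion_algebra`. [cite: Luscher1977, pp. 283–292] -/
theorem insertion_undress (Pp Pm Bh C W₁ W₁' W₂ W₂' J : Matrix n n ℂ) (h1 : Pp + Pm = 1)
    (hPP : Pp * Pp = Pp) (hQQ : Pm * Pm = Pm) (hPQ : Pp * Pm = 0) (hQP : Pm * Pp = 0)
    (hBP : Bh * Pp = Pp * Bh) (hBQ : Bh * Pm = Pm * Bh) (hPCP : Pp * C * Pp = 0)
    (hQCQ : Pm * C * Pm = 0) (hW₁P : W₁ * Pp = Pp * W₁) (hW₁Q : W₁ * Pm = Pm * W₁)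
    (hW₁'P : W₁' * Pp = Pp * W₁') (hW₁'Q : W₁' * Pm = Pm * W₁') (hW₂P : W₂ * Pp = Pp * W₂)
    (hW₂Q : W₂ * Pm = Pm * W₂) (hW₂'P : W₂' * Pp = Pp * W₂') (hW₂'Q : W₂' * Pm = Pm * W₂')
    (hW₁'W₁ : W₁' * W₁ = 1) (hW₁W₁' : W₁ * W₁' = 1) (hW₂'W₂ : W₂' * W₂ = 1)
    (hW₂W₂' : W₂ * W₂' = 1) (hBh : IsUnit Bh.det) :
    (W₁' * Pp + Pm) * (((Bh + C) * Pm - Pp * W₁')⁻¹ * J *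
        (Pm - Pp * ((Bh + C) * Pp - Pm * W₂)⁻¹ * ((Bh + C) * Pm - Pp * W₁'))) * (W₁ * Pp + Pm) =
      (-Pp + Pp * C * Bh⁻¹ * Pm + Bh⁻¹ * Pm) * J *
        (Pm + Pp * ((1 + Pm * C * Pp) * (Bh⁻¹ * Pp + Bh * Pm) * (1 - Pp * C * Pm))) ∧
    (((Bh + C) * Pm - Pp * W₁')⁻¹ * J * Pm).trace = (J * Bh⁻¹ * Pm).trace := by
  obtain ⟨-, -, h3, -, h5, h6⟩ := stub_chainBlock_insertion_algebra n Pp Pm Bh Bh⁻¹ C W₁ W₁' W₂ W₂'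
    J h1 hPP hQQ hPQ hQP (Matrix.mul_nonsing_inv _ hBh) (Matrix.nonsing_inv_mul _ hBh) hBP hBQ hPCP
    hQCQ hW₁P hW₁Q hW₁'P hW₁'Q hW₂P hW₂Q hW₂'P hW₂'Q hW₁'W₁ hW₁W₁' hW₂'W₂ hW₂W₂'
  have hE : ((Bh + C) * Pm - Pp * W₁') * (-W₁ * Pp + W₁ * Pp * C * Bh⁻¹ * Pm + Bh⁻¹ * Pm) = 1 := by
    rw [neg_mul]
    exact projChainBlock_mul_explicitInv n Pp Pm Bh C W₁ W₁' h1 hPP hQQ hPQ hQP hBP hBQ hQCQ hW₁'P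
      hW₁Q hW₁'W₁ hBh
  set E := (Bh + C) * Pm - Pp * W₁'
  set F := (Bh + C) * Pp - Pm * W₂
  set Et := -W₁ * Pp + W₁ * Pp * C * Bh⁻¹ * Pm + Bh⁻¹ * Pm
  set Ni := (Pp + W₂' * Pm) * ((1 + Pm * C * Pp) * (Bh⁻¹ * Pp + Bh * Pm) * (1 - Pp * C * Pm)) *
    (W₁' * Pp + Pm)
  have hEtE : Et * E = 1 := mul_eq_one_comm.mp hE
  have hFN : F * Ni = -E := by
    calc F * Ni = E * Et * F * Ni := by rw [hE, Matrix.one_mul]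
      _ = -(E * (-Et * F * Ni)) := by
          simp only [Matrix.mul_assoc, neg_mul, Matrix.mul_neg, neg_neg]
      _ = -E := by rw [h3, Matrix.mul_one]
  have hF : F * -(Ni * Et) = 1 := by
    rw [Matrix.mul_neg, ← Matrix.mul_assoc, hFN, neg_mul, neg_neg, hE]
  have hins : Pm - Pp * F⁻¹ * E = Pm + Pp * Ni := by
    rw [Matrix.inv_eq_right_inv hF, Matrix.mul_neg, neg_mul, sub_neg_eq_add, Matrix.mul_assoc,
      Matrix.mul_assoc, hEtE, Matrix.mul_one]
  rw [Matrix.inv_eq_right_inv hE, hins]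
  exact ⟨h5, h6⟩

/-- `Matrix.reindex e e 1 = 1`. [folklore] -/
theorem reindex_one {m k : Type*} [DecidableEq m] [DecidableEq k] (e : m ≃ k) :
    Matrix.reindex e e (1 : Matrix m m ℂ) = 1 := by
  rw [Matrix.reindex_apply, Matrix.submatrix_one_equiv]

end OneParticle

/-! ### Fock-level identities -/

section Fock

variable {ι : Type*} [LinearOrder ι] [Fintype ι]

/-- **Conjugating a shifted `dΓ` by `Γ` of an invertible one-particle matrix**:
`Γ(gᵢ) (dΓ(Z) − c·1) Γ(g) = dΓ(gᵢ Z g) − c·1` whenever `gᵢ g = 1` (covariance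
`Γ(gᵢ) dΓ(Z) Γ(gᵢ⁻¹) = dΓ(gᵢ Z gᵢ⁻¹)`, `StubGammaConjDGamma.Gamma_mul_dGamma_mul_Gamma_inv`, and
`Γ(gᵢ) Γ(gᵢ⁻¹) = 1`). Dereziński–Gérard Prop. 3.23 (1). [folklore] -/
theorem fockLift_conj_dGamma_sub_smul {g gi : Matrix ι ι ℂ} (h : gi * g = 1) (Z : Matrix ι ι ℂ)
    (c : ℂ) :
    fockLift gi * (dGamma Z - c • (1 : Matrix (Finset ι) (Finset ι) ℂ)) * fockLift g =
      dGamma (gi * Z * g) - c • (1 : Matrix (Finset ι) (Finset ι) ℂ) := by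
  have hdet : IsUnit gi.det := Matrix.isUnit_det_of_right_inverse h
  have hinv : gi⁻¹ = g := Matrix.inv_eq_right_inv h
  rw [← hinv, fockLift_eq_Gamma', fockLift_eq_Gamma', Matrix.mul_sub, Matrix.sub_mul,
    StubGammaConjDGamma.Gamma_mul_dGamma_mul_Gamma_inv hdet, Matrix.mul_smul, Matrix.mul_one,
    Matrix.smul_mul, Gamma_mul_inv hdet]

/-- **Fock-level undressing with a conjugated insertion** (the assembly step).  If the one-step
matrices factor as `N_t = S_{t−1} X_t Sᵢ_t` with `S_t Sᵢ_t = 1`, and the one-particle insertion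
matrix satisfies `Sᵢ_{t₀−1} Z S_{t₀−1} = K`, `c = c′`, then
`STr ∏_{i<T} (𝒬_i Γ(reindex N_i)) = STr ∏_{i<T} (𝒬′_i Γ(reindex X_i))` for the insertions
`𝒬_{t₀} = dΓ(reindex Z) − c·1`, `𝒬′_{t₀} = dΓ(reindex K) − c′·1` (and `1` off the source slice):
`Γ(reindex N_i) = Γ(reindex S_{i−1}) Γ(reindex X_i) Γ(reindex S_i)⁻¹`, the landed cyclic undressing
`stub_supertrace_undress_insert`, and `Γ(Sᵢ)(dΓ(Z) − c)Γ(S) = dΓ(Sᵢ Z S) − c`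
(`fockLift_conj_dGamma_sub_smul`), `Γ(Sᵢ) Γ(S) = 1`. [cite: Luscher1977, pp. 283–292] -/
theorem supertrace_undress_of_dressing {m : Type*} [Fintype m] [DecidableEq m] {d : ℕ} (T : ℕ)
    (e : m ≃ Fin d) (t₀ : ZMod T) (S Si X Nm : ZMod T → Matrix m m ℂ) (Z K : Matrix m m ℂ)
    (c c' : ℂ) (hSS : ∀ t, S t * Si t = 1) (hN : ∀ t, Nm t = S (t - 1) * X t * Si t)
    (hZ : Si (t₀ - 1) * Z * S (t₀ - 1) = K) (hc : c = c') :
    ∑ s : Finset (Fin d), (-1 : ℂ) ^ s.card *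
        (((List.range T).map fun i : ℕ =>
          (if (i : ZMod T) = t₀ then
              dGamma (Matrix.reindex e e Z) - c • (1 : Matrix (Finset (Fin d)) (Finset (Fin d)) ℂ)
            else 1) *
          fockLift (Matrix.reindex e e (Nm (i : ZMod T)))).prod) s s =
      ∑ s : Finset (Fin d), (-1 : ℂ) ^ s.card *
        (((List.range T).map fun i : ℕ =>
          (if (i : ZMod T) = t₀ then
              dGamma (Matrix.reindex e e K) - c' • (1 : Matrix (Finset (Fin d)) (Finset (Fin d)) ℂ)
            else 1) *
          fockLift (Matrix.reindex e e (X (i : ZMod T)))).prod) s s := by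
  subst hc
  have hSiS : ∀ t, Si t * S t = 1 := fun t => mul_eq_one_comm.mp (hSS t)
  have hSS' : ∀ t, Matrix.reindex e e (S t) * Matrix.reindex e e (Si t) = 1 := fun t => by
    rw [← reindex_mul_reindex, hSS, reindex_one]
  have hSiS' : ∀ t, Matrix.reindex e e (Si t) * Matrix.reindex e e (S t) = 1 := fun t => by
    rw [← reindex_mul_reindex, hSiS, reindex_one]
  have hdet : ∀ t, IsUnit (Matrix.reindex e e (S t)).det := fun t =>
    Matrix.isUnit_det_of_right_inverse (hSS' t)
  have hinv : ∀ t, (Matrix.reindex e e (S t))⁻¹ = Matrix.reindex e e (Si t) := fun t =>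
    Matrix.inv_eq_right_inv (hSS' t)
  -- the conjugated insertions
  have hQ : ∀ t : ZMod T,
      fockLift (Matrix.reindex e e (Si (t - 1))) *
          (if t = t₀ then
              dGamma (Matrix.reindex e e Z) - c • (1 : Matrix (Finset (Fin d)) (Finset (Fin d)) ℂ)
            else 1) *
        fockLift (Matrix.reindex e e (S (t - 1))) =
      (if t = t₀ then
          dGamma (Matrix.reindex e e K) - c • (1 : Matrix (Finset (Fin d)) (Finset (Fin d)) ℂ)
        else 1) := by
    intro t
    by_cases ht : t = t₀
    · rw [if_pos ht, if_pos ht, fockLift_conj_dGamma_sub_smul (hSiS' _), ← reindex_mul_reindex,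
        ← reindex_mul_reindex, ht, hZ]
    · rw [if_neg ht, if_neg ht, Matrix.mul_one, ← fockLift_mul, hSiS', fockLift_one]
  -- factorising the dressed one-step operators
  have hL : (fun i : ℕ =>
        (if (i : ZMod T) = t₀ then
            dGamma (Matrix.reindex e e Z) - c • (1 : Matrix (Finset (Fin d)) (Finset (Fin d)) ℂ)
          else 1) *
        fockLift (Matrix.reindex e e (Nm (i : ZMod T)))) =
      fun i : ℕ =>
        (if (i : ZMod T) = t₀ then
            dGamma (Matrix.reindex e e Z) - c • (1 : Matrix (Finset (Fin d)) (Finset (Fin d)) ℂ)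
          else 1) *
        fockLift (Matrix.reindex e e (S ((i : ZMod T) - 1))) *
        fockLift (Matrix.reindex e e (X (i : ZMod T))) *
        fockLift ((Matrix.reindex e e (S (i : ZMod T)))⁻¹) := by
    funext i
    rw [hN, reindex_mul_reindex, reindex_mul_reindex, fockLift_mul, fockLift_mul, hinv]
    simp only [Matrix.mul_assoc]
  have hR : (fun i : ℕ =>
        (if (i : ZMod T) = t₀ then
            dGamma (Matrix.reindex e e K) - c • (1 : Matrix (Finset (Fin d)) (Finset (Fin d)) ℂ)
          else 1) *
        fockLift (Matrix.reindex e e (X (i : ZMod T)))) =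
      fun i : ℕ =>
        fockLift ((Matrix.reindex e e (S ((i : ZMod T) - 1)))⁻¹) *
        (if (i : ZMod T) = t₀ then
            dGamma (Matrix.reindex e e Z) - c • (1 : Matrix (Finset (Fin d)) (Finset (Fin d)) ℂ)
          else 1) *
        fockLift (Matrix.reindex e e (S ((i : ZMod T) - 1))) *
        fockLift (Matrix.reindex e e (X (i : ZMod T))) := by
    funext i
    rw [hinv, hQ]
  rw [hL, hR]
  exact StubSupertraceUndressInsert.supertrace_undress_insert T (fun t => Matrix.reindex e e (S t))
    (fun t => if t = t₀ then
      dGamma (Matrix.reindex e e Z) - c • (1 : Matrix (Finset (Fin d)) (Finset (Fin d)) ℂ) else 1)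
    (fun t => fockLift (Matrix.reindex e e (X t))) hdet

end Fock

end StubWilsonChainUndressInsertion

/-- **E2 F2: undressing the temporal transporters in the presence of the source insertion**
(registered stub signature verbatim).  For Wilson-structured slice operators `A_t = Bh_t + C_t` on
`X × Fin N × Fin 4` (sites × colour × spin) — `Bh_t` invertible and commuting with the lifted Wilson
time projections `P± = 1 ⊗ 1 ⊗ ½(1 ± γ₀)`, `P⁺ C_t P⁺ = P⁻ C_t P⁻ = 0` — and mutually inverse
temporal transporters `W_t`, `Wi_t` commuting with `P±`, the cyclic supertrace of the dressed chain
with the F1 source insertion at slice `t₀`,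
`STr ∏_{i<T} (𝒥_i Γ(N_i))`, `N_i = −E_i⁻¹ F_i`, `𝒥_{t₀} = dΓ(E⁻¹ J (P⁻ − P⁺ F⁻¹ E)) − tr(E⁻¹ J P⁻)·1`,
equals the undressed one `STr ∏_{i<T} (𝒦_i Γ(M′_i W_i))` with the LINK-FREE insertion
`𝒦_{t₀} = dΓ((−P⁺ + P⁺ C Bh⁻¹ P⁻ + Bh⁻¹ P⁻) J (P⁻ + P⁺ M′ᵢ)) − tr(J Bh⁻¹ P⁻)·1`
(`M′ = (1 + P⁺CP⁻)(Bh P⁺ + Bh⁻¹P⁻)(1 − P⁻CP⁺)` Lüscher's positive core, `M′ᵢ` its inverse; all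
one-particle matrices transported to `Fin d` along `e`).  Assembly of
`StubWilsonChainUndressInsertion.supertrace_undress_of_dressing` at the lifted projections.
[cite: Luscher1977, pp. 283–292] -/
theorem stub_wilsonChain_undress_insertion :
    ∀ (T : ℕ) [NeZero T] (X : Type) [Fintype X] [DecidableEq X] (N d : ℕ) (e : X × Fin N × Fin 4 ≃ Fin d)
      (Bh C W Wi : ZMod T → Matrix (X × Fin N × Fin 4) (X × Fin N × Fin 4) ℂ) (t₀ : ZMod T)
      (J : Matrix (X × Fin N × Fin 4) (X × Fin N × Fin 4) ℂ),
      let Pp : Matrix (X × Fin N × Fin 4) (X × Fin N × Fin 4) ℂ := Matrix.of fun a b =>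
        if a.1 = b.1 ∧ a.2.1 = b.2.1 then ((1 / 2 : ℂ) • (1 + euclideanGamma 0)) a.2.2 b.2.2 else 0;
      let Pm : Matrix (X × Fin N × Fin 4) (X × Fin N × Fin 4) ℂ := Matrix.of fun a b =>
        if a.1 = b.1 ∧ a.2.1 = b.2.1 then ((1 / 2 : ℂ) • (1 - euclideanGamma 0)) a.2.2 b.2.2 else 0;
      (∀ t, Bh t * Pp = Pp * Bh t) → (∀ t, Bh t * Pm = Pm * Bh t) →
      (∀ t, Pp * C t * Pp = 0) → (∀ t, Pm * C t * Pm = 0) →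
      (∀ t, W t * Pp = Pp * W t) → (∀ t, W t * Pm = Pm * W t) →
      (∀ t, Wi t * Pp = Pp * Wi t) → (∀ t, Wi t * Pm = Pm * Wi t) →
      (∀ t, Wi t * W t = 1) → (∀ t, W t * Wi t = 1) → (∀ t, IsUnit (Bh t).det) →
      ∑ S : Finset (Fin d), (-1 : ℂ) ^ S.card *
          (((List.range T).map fun i : ℕ =>
            (if (i : ZMod T) = t₀ then
                dGamma (Matrix.reindex e e (((Bh t₀ + C t₀) * Pm - Pp * Wi (t₀ - 1))⁻¹ * J *
                  (Pm - Pp * ((Bh t₀ + C t₀) * Pp - Pm * W t₀)⁻¹ * ((Bh t₀ + C t₀) * Pm - Pp * Wi (t₀ - 1))))) -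
                (((Bh t₀ + C t₀) * Pm - Pp * Wi (t₀ - 1))⁻¹ * J * Pm).trace • (1 : Matrix (Finset (Fin d)) (Finset (Fin d)) ℂ)
              else 1) *
            fockLift (Matrix.reindex e e (-(((Bh (i : ZMod T) + C (i : ZMod T)) * Pm - Pp * Wi ((i : ZMod T) - 1))⁻¹ *
              ((Bh (i : ZMod T) + C (i : ZMod T)) * Pp - Pm * W (i : ZMod T)))))).prod) S S =
        ∑ S : Finset (Fin d), (-1 : ℂ) ^ S.card *
          (((List.range T).map fun i : ℕ =>
            (if (i : ZMod T) = t₀ then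
                dGamma (Matrix.reindex e e ((-Pp + Pp * C t₀ * (Bh t₀)⁻¹ * Pm + (Bh t₀)⁻¹ * Pm) * J *
                  (Pm + Pp * ((1 + Pm * C t₀ * Pp) * ((Bh t₀)⁻¹ * Pp + Bh t₀ * Pm) * (1 - Pp * C t₀ * Pm))))) -
                (J * (Bh t₀)⁻¹ * Pm).trace • (1 : Matrix (Finset (Fin d)) (Finset (Fin d)) ℂ)
              else 1) *
            fockLift (Matrix.reindex e e (((1 + Pp * C (i : ZMod T) * Pm) * (Bh (i : ZMod T) * Pp + (Bh (i : ZMod T))⁻¹ * Pm) *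
              (1 - Pm * C (i : ZMod T) * Pp)) * W (i : ZMod T)))).prod) S S := by
  intro T _ X _ _ N d e Bh C W Wi t₀ J Pp Pm hBP hBQ hPCP hQCQ hWP hWQ hWiP hWiQ hWiW hWWi hBh
  have h1 : Pp + Pm = 1 := liftProjPlus_add_liftProjMinus X N
  have hPQ : Pp * Pm = 0 := liftProjPlus_mul_liftProjMinus X N
  have hQP : Pm * Pp = 0 := liftProjMinus_mul_liftProjPlus X N
  have hPP : Pp * Pp = Pp := StubWilsonChainUndressInsertion.mul_self_of_add_eq_one h1 hPQ
  have hQQ : Pm * Pm = Pm := StubWilsonChainUndressInsertion.mul_self_of_add_eq_one' h1 hQP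
  obtain ⟨hZ, hc⟩ := StubWilsonChainUndressInsertion.insertion_undress Pp Pm (Bh t₀) (C t₀)
    (W (t₀ - 1)) (Wi (t₀ - 1)) (W t₀) (Wi t₀) J h1 hPP hQQ hPQ hQP (hBP _) (hBQ _) (hPCP _) (hQCQ _)
    (hWP _) (hWQ _) (hWiP _) (hWiQ _) (hWP _) (hWQ _) (hWiP _) (hWiQ _) (hWiW _) (hWWi _) (hWiW _)
    (hWWi _) (hBh _)
  exact StubWilsonChainUndressInsertion.supertrace_undress_of_dressing T e t₀
    (fun t => W t * Pp + Pm) (fun t => Wi t * Pp + Pm)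
    (fun t => (1 + Pp * C t * Pm) * (Bh t * Pp + (Bh t)⁻¹ * Pm) * (1 - Pm * C t * Pp) * W t)
    (fun t => -(((Bh t + C t) * Pm - Pp * Wi (t - 1))⁻¹ * ((Bh t + C t) * Pp - Pm * W t)))
    _ _ _ _
    (fun t => StubChainBlockInsertionAlgebra.left_pair_mul Pp Pm (W t) (Wi t) h1 hPP hQQ hPQ hQP
      (hWWi t) (hWiP t))
    (fun t => StubWilsonChainUndressInsertion.neg_inv_mul_eq_dressed Pp Pm (Bh t) (C t) (W (t - 1))
      (Wi (t - 1)) (W t) (Wi t) h1 hPP hQQ hPQ hQP (hBP t) (hBQ t) (hPCP t) (hQCQ t) (hWQ _) (hWiP _)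
      (hWiW _) (hWQ t) (hWWi t) (hBh t))
    hZ hc

end Summit.QuantumFields.QCD.Cruxes.RobustYangMillsHandover.PinTheInfimum
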